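import Literature.MathematicalPhysics.QuantumLattice.HubbardModel
import Literature.MathematicalPhysics.QuantumLattice.HubbardRectangularTorus
import Literature.MathematicalPhysics.QuantumLattice.HubbardTorus2DEnergyDensity
import Literature.MathematicalPhysics.QuantumLattice.HeisenbergModel
import Literature.MathematicalPhysics.QuantumLattice.HubbardDoubleOccupancyBounds
import Literature.MathematicalPhysics.QuantumLattice.HubbardFreeKineticLowerBound
import Literature.MathematicalPhysics.QuantumLattice.HubbardTorus2DEnergyDensityConvex
import Literature.MathematicalPhysics.QuantumLattice.HubbardEnergyDensityChemicalPotential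
import Literature.MathematicalPhysics.QuantumLattice.HubbardModelParticleHoleProofs
import Literature.MathematicalPhysics.QuantumLattice.HubbardHubbardModelEtaPairingProofs
import Literature.MathematicalPhysics.QuantumLattice.HubbardModelProofs
import HarnessLib
import HarnessLib.Audit
import Summits.HubbardSuperconductivity.ManyBodyBootstrap.Bounds.Adv1.TransportU1
import Summits.HubbardSuperconductivity.ManyBodyBootstrap.Bounds.Adv1.Defs

/-!
# Many-body bootstrap — Bounds/Adv1 §F (PROVED): transported endpoint `lo_chord_T6_U6` (chord at U = 6 on the 6×6 torus)

Part `TransportU3` (2/2) of the cell's staged module `HubbardCertifiedBoundsAdv1.lean` (sha256 `6b6fb8f2133654a2…`).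
Filed under the cell topic `ManyBodyBootstrap` (lit seat pub-mbboot, tool `file_parts_g19.py`; unit→part table in HOME/PLACEMENT.md);
family map, certificate provenance (two implementations per certificate) and the PROVED soundness theorems: see part `Adv1/Defs`.
Declarations are the staged ones, byte-identical up to the namespace (`…Bounds.Adv1` → `…ManyBodyBootstrap.Bounds.Adv1`), `@[conjecture]`
on every certificate CLAIM NODE (`def … : Prop`, an open obligation node closable in-kernel from the certificate's exact data — NOT a
vendored fact) and a closing `[computation: <kind>, exact ℚ]` tag in its docstring. HONEST FRAMING: adversarial comparison against published
numerics, certified intervals only; certified numerical bounds on a lattice model; not superconductivity, not a phase diagram.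
-/

noncomputable section

namespace Summit.HubbardSuperconductivity.ManyBodyBootstrap.Bounds.Adv1

open Literature.MathematicalPhysics.QuantumLattice Literature.MathematicalPhysics.QuantumLattice.ThermodynamicLimit
open Literature.Probability.LatticeModels
open Matrix

/-- TRANSPORTED LOWER ENDPOINT of block [T6_U6] (gen 9, PROVED from the two parent endpoints as hypotheses): concavity of `U ↦ E₀(6×6 torus, N = 36, U)` (`groundEnergyAt (fermionRectTorusGraph 6 6) 1 U 36`) in `U` ⇒ the chord value at `U = 6`, `((U₂−U)·L₁ + (U−U₁)·L₂)/(U₂−U₁) = -9172129754412654802093451/302231454903657293676544` ≈ -30.3480316, is a lower bound; parents: `L₁ = -5197084502421598641177995/151115727451828646838272` ≈ -34.3914203 at `U₁ = 4` (direct certified lower endpoint of block [T6_U4]) and `L₂ = -7230565191987/274877906944` ≈ -26.3046429 at `U₂ = 8` (direct certified lower endpoint of block [T6_U8]). The rational on the right is the one printed in RESULTS-ADV.md; the kernel re-derives it here from the parents' literals (second implementation of `make_results_adv.py`'s exact arithmetic). `adv1g9_transport.json` (sha256 c39167be84b064a8…). -/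
theorem lo_chord_T6_U6 (h₁ : E0Lower 6 6 1 (4 : ℚ) 36 ((-5197084502421598641177995 : ℚ) / 151115727451828646838272))
    (h₂ : E0Lower 6 6 1 (8 : ℚ) 36 ((-7230565191987 : ℚ) / 274877906944)) :
    E0Lower 6 6 1 (6 : ℚ) 36 ((-9172129754412654802093451 : ℚ) / 302231454903657293676544) := by
  simp only [E0Lower] at *
  push_cast at *
  have h₁' := h₁
  have hc := chord_le_of_concaveOn (DoubleOccupancy.concaveOn_groundEnergyAt (fermionRectTorusGraph 6 6) (1 : ℝ) 36)
    (Set.mem_univ ((4 : ℝ))) (Set.mem_univ ((8 : ℝ))) (z := (6 : ℝ)) (by norm_num) (by norm_num) h₁' h₂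
  linarith

end Summit.HubbardSuperconductivity.ManyBodyBootstrap.Bounds.Adv1

end
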